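import Summits.Schanuel.Schanuel.Theorems.ZilberEacComplexGraphEscapeTopLemmas
import Summits.Schanuel.Schanuel.Theorems.ZilberEacComplexHypersurfaceEscape
import HarnessLib

/-!
# Linear escape over an arbitrary hypersurface base: polynomial top coefficients

Zilber's Exponential-Algebraic Closedness, range `dim π₁(V) = n - 1` (first open rung, Mantova–Masser,
PLMS 129 (2024), §1 p. 5), for the `n`-folds over an ARBITRARY hypersurface base `{H = 0} ⊆ ℂⁿ` swept by
the Laurent-parametrised fibre curves `yᵢ = Tᵢ(x) t^{νᵢ} + Σ_{m ∈ Sᵢ, m < νᵢ} A_{i,m}(x) tᵐ` with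
POLYNOMIAL top coefficients `Tᵢ ∈ ℂ[x]` — in particular (`ν = -eₙ`) the Brownawell–Masser-type puncture
fibres `yⱼ = Tⱼ(x) + O(yₙ)`, `yₙ → 0`, of this packet's Theorems A/A₀ (graph bases) and S/Q (spheres,
cyclic covers), now over any hypersurface. Hypotheses: a simple root `λ`, `Re λ > 0`, of the lattice
polynomial `H_D(λν + 2πiq)` (as in Theorem H_esc, `ZilberEacComplexHypersurfaceEscape.lean`) and
non-vanishing of the leading forms `(Tᵢ)_{deg Tᵢ}` at `v = λν + 2πiq`. Mechanism: linear escape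
`x = mv + u` with moving logarithms `u = (η₀ + e^ω - 1)ν + d log m + log t + ζ` (`dᵢ = deg Tᵢ`,
`tᵢ = (Tᵢ)_{dᵢ}(v)`, so `e^{xᵢ} = tᵢ m^{dᵢ} e^{νᵢL} e^{ζᵢ}` and `Tᵢ(x)/(tᵢ m^{dᵢ}) = 1 + O(logᴺ m / m)`), the
base equation solved to second order by the explicit affine shift `η₀`, contraction
`Literature.NumberTheory.Transcendental.ExpDominant.exists_exp_eq_one_add` in `n + 1` unknowns.

* `exists_expPoint_hypersurfaceEscape_top` — **EC for the class above** (Theorem H_esc^top).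

HONEST FRAMING: a modest new sub-rung of EAC; nothing here bears on Schanuel's conjecture.
-/

noncomputable section

open Complex MvPolynomial Metric Set Filter Topology

set_option linter.dupNamespace false

namespace Summit.Schanuel.Schanuel.Theorems

set_option maxHeartbeats 800000 in
/-- **EC by linear escape over an arbitrary hypersurface base, polynomial top coefficients
(Theorem H_esc^top).** Let `H ∈ ℂ[x₁..xₙ]` have total degree `D ≥ 1`; `ν, q ∈ ℤⁿ`, `λ ∈ ℂ` with
`Re λ > 0`, `v = λν + 2πiq`, `H_D(v) = 0`, `Σᵢ νᵢ∂ᵢH_D(v) ≠ 0`; `Tᵢ ∈ ℂ[x]` with `(Tᵢ)_{deg Tᵢ}(v) ≠ 0`;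
`Sᵢ ⊆ ℤ` finite below `νᵢ`; `A_{i,m} ∈ ℂ[x]` arbitrary. Then there are `x` with `H(x) = 0` and `L` with
`e^{xᵢ} = Tᵢ(x) e^{νᵢL} + Σ_{m ∈ Sᵢ} A_{i,m}(x) e^{mL}` for all `i`: the `n`-fold swept by the fibre curves
`yᵢ = Tᵢ(x)t^{νᵢ} + Σ A_{i,m}(x)tᵐ` over `{H = 0}` (`dim π₁ V = n - 1`, first open range of
Exponential-Algebraic Closedness, Mantova–Masser 2024 §1 p. 5) meets the graph of `exp`. Generalizes
Theorem H_esc (constant `Tᵢ`). New. [cite: MantovaMasser2023, §1 p.5 (the open case dim π(V) = 2 in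
ℂ³×ℂˣ³)] -/
theorem exists_expPoint_hypersurfaceEscape_top {n : ℕ} (H : MvPolynomial (Fin n) ℂ)
    (hD : 1 ≤ H.totalDegree) (ν q : Fin n → ℤ) (lam : ℂ) (hre : 0 < lam.re)
    (hroot : eval (fun i => lam * (ν i : ℂ) + 2 * Real.pi * I * (q i : ℂ))
      (homogeneousComponent H.totalDegree H) = 0)
    (hβ : ∑ i, (ν i : ℂ) * eval (fun i => lam * (ν i : ℂ) + 2 * Real.pi * I * (q i : ℂ))
      (pderiv i (homogeneousComponent H.totalDegree H)) ≠ 0)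
    (T : Fin n → MvPolynomial (Fin n) ℂ)
    (hT : ∀ i, eval (fun i => lam * (ν i : ℂ) + 2 * Real.pi * I * (q i : ℂ))
      (homogeneousComponent (T i).totalDegree (T i)) ≠ 0)
    (S : Fin n → Finset ℤ) (hS : ∀ i, ∀ m ∈ S i, m < ν i) (A : Fin n → ℤ → MvPolynomial (Fin n) ℂ) :
    ∃ x : Fin n → ℂ, ∃ L : ℂ, eval x H = 0 ∧ ∀ i,
      exp (x i) = eval x (T i) * exp ((ν i : ℂ) * L) +
        ∑ m ∈ S i, eval x (A i m) * exp ((m : ℂ) * L) := by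
  classical
  set D := H.totalDegree with hDdef
  set v : Fin n → ℂ := fun i => lam * (ν i : ℂ) + 2 * Real.pi * I * (q i : ℂ) with hv
  set HD := homogeneousComponent D H with hHD
  set gD : Fin n → ℂ := fun j => eval v (pderiv j HD) with hgD
  set β : ℂ := ∑ i, (ν i : ℂ) * gD i with hβdef
  have hβ0 : β ≠ 0 := hβ
  have hβpos : 0 < ‖β‖ := norm_pos_iff.mpr hβ0
  set h1 : ℂ := eval v (homogeneousComponent (D - 1) H) with hh1
  set ρ : ℝ := lam.re with hρ
  set d : Fin n → ℕ := fun i => (T i).totalDegree with hd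
  set t : Fin n → ℂ := fun i => eval v (homogeneousComponent (d i) (T i)) with ht
  have ht0 : ∀ i, t i ≠ 0 := fun i => hT i
  set ℓ : Fin n → ℂ := fun i => log (t i) with hℓ
  have hexpℓ : ∀ i, exp (ℓ i) = t i := fun i => Complex.exp_log (ht0 i)
  set νc : Fin n → ℂ := fun i => (ν i : ℂ) with hνc
  obtain ⟨C2, hC20, N2, hC2⟩ := exists_norm_eval_ray_secondOrder_le H hD v
  have hrayT := fun i => exists_norm_eval_ray_sub_le (T i) v
  choose CT hCT0 NT hCT using hrayT
  have hgrowth := fun i m =>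
    Literature.NumberTheory.Transcendental.HypersurfaceCover.exists_norm_eval_le_pow (A i m)
  choose CA hCA0 NA hCA using hgrowth
  set ε : ℝ := 1 / (16 * ((n : ℝ) + 2)) with hε
  have hεpos : 0 < ε := by positivity
  set c₁ : ℝ := ∑ j, (d j : ℝ) with hc₁
  have hc₁0 : 0 ≤ c₁ := by positivity
  have hdc₁ : ∀ j, (d j : ℝ) ≤ c₁ := fun j =>
    Finset.single_le_sum (f := fun j => (d j : ℝ)) (fun i _ => by positivity) (Finset.mem_univ j)
  set c₂ : ℝ := ‖ℓ‖ + 1 with hc₂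
  set G₁ : ℝ := (∑ j, ‖gD j‖) * ‖β‖⁻¹ with hG₁
  set G₂ : ℝ := ‖h1‖ * ‖β‖⁻¹ with hG₂
  set a₁ : ℝ := (G₁ * c₁) * ‖νc‖ + c₁ with ha₁
  set a₂ : ℝ := (G₁ * c₂ + G₂ + 2) * ‖νc‖ + c₂ with ha₂
  have ha₁0 : 0 ≤ a₁ := by positivity
  have ha₂0 : 0 ≤ a₂ := by positivity
  set Kx : ℝ := 1 + ‖v‖ + a₁ + a₂ with hKx
  have hKx0 : 0 ≤ Kx := by rw [hKx]; positivity
  have hν1 : 1 ≤ ‖νc‖ := by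
    by_contra hlt
    rw [not_le] at hlt
    apply hβ0
    rw [hβdef]
    refine Finset.sum_eq_zero fun i _ => ?_
    have hi : ‖νc i‖ < 1 := (norm_le_pi_norm νc i).trans_lt hlt
    have hzi : ν i = 0 := by
      simp only [hνc, Complex.norm_intCast] at hi
      exact Int.abs_lt_one_iff.mp (by exact_mod_cast hi)
    simp [hzi]
  set Ff : Fin n → ℝ → ℝ := fun i m =>
    (CT i * 2 ^ d i * ((1 + a₁ * Real.log m + a₂) ^ NT i / m) +
      ∑ m' ∈ S i, CA i m' * Kx ^ NA i m' * ((1 + m) ^ NA i m' * Real.exp (-(ρ / 2 * m - 0)))) /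
      ‖t i‖ with hFf
  set Fl : ℝ → ℝ := fun m => C2 * ((1 + a₁ * Real.log m + a₂) ^ N2 / m) / ‖β‖ with hFl
  set Fr : ℝ → ℝ := fun m => (1 + a₁ * Real.log m + a₂) ^ 1 / m with hFr
  have hFft : ∀ i, Tendsto (Ff i) atTop (𝓝 0) := by
    intro i
    have h := tendsto_finsetSum (S i) fun m' _ =>
      (tendsto_one_add_pow_mul_exp_neg_lin (NA i m') (half_pos hre) 0).const_mul
        (CA i m' * Kx ^ NA i m')
    simp only [mul_zero, Finset.sum_const_zero] at h
    have h2 := ((tendsto_one_add_log_pow_div ha₁0 ha₂0 (NT i)).const_mul (CT i * 2 ^ d i)).add h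
    rw [mul_zero, add_zero] at h2
    have h3 := h2.div_const ‖t i‖
    rwa [zero_div] at h3
  have hFlt : Tendsto Fl atTop (𝓝 0) := by
    have h := ((tendsto_one_add_log_pow_div ha₁0 ha₂0 N2).const_mul C2).div_const ‖β‖
    rwa [mul_zero, zero_div] at h
  have hFrt : Tendsto Fr atTop (𝓝 0) := tendsto_one_add_log_pow_div ha₁0 ha₂0 1
  have hev : ∀ᶠ m : ℝ in atTop,
      ((∀ i, Ff i m ≤ ε) ∧ Fl m ≤ ε) ∧ (Fr m ≤ ρ / 2 ∧ 2 ≤ m) := by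
    refine ((eventually_all.2 fun i => ?_).and ?_).and (Filter.Eventually.and ?_ (eventually_ge_atTop _))
    · exact (hFft i).eventually (ge_mem_nhds hεpos)
    · exact hFlt.eventually (ge_mem_nhds hεpos)
    · exact hFrt.eventually (ge_mem_nhds (half_pos hre))
  obtain ⟨R, hR⟩ := Filter.eventually_atTop.mp hev
  obtain ⟨mN, hmN⟩ := exists_nat_ge R
  set m : ℝ := (mN : ℝ) with hm
  obtain ⟨⟨hFε, hFlε⟩, hFr2, hm2⟩ := hR m hmN
  have hm1 : 1 ≤ m := by linarith
  have hmpos : 0 < m := by linarith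
  have hlog0 : 0 ≤ Real.log m := Real.log_nonneg hm1
  have hmC : (m : ℂ) ≠ 0 := by exact_mod_cast hmpos.ne'
  have hmD : ((m : ℂ) ^ (D - 1) * β) ≠ 0 := mul_ne_zero (pow_ne_zero _ hmC) hβ0
  have hmnorm : ‖(m : ℂ)‖ = m := by rw [Complex.norm_real, Real.norm_of_nonneg hmpos.le]
  set lm : ℝ := Real.log m with hlm
  set W : ℝ := c₁ * lm + c₂ with hW
  have hW0 : 0 ≤ W := by positivity
  have hWm : 1 + a₁ * lm + a₂ = 1 + ((G₁ * W + G₂) + 2) * ‖νc‖ + W := by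
    simp only [hW, ha₁, ha₂]; ring
  have hlmm : lm ≤ m := (Real.log_le_sub_one_of_pos hmpos).trans (by linarith)
  -- ### the maps of the fixed-point problem on `ℂ^{n+1} ∋ ξ = (ζ, ω)`
  set η₀f : (Fin (n + 1) → ℂ) → ℂ := fun ξ =>
    -((∑ j, ((d j : ℂ) * lm + ℓ j + ξ (Fin.castSucc j)) * gD j) + h1) * β⁻¹ with hη₀f
  set Ef : (Fin (n + 1) → ℂ) → ℂ := fun ξ => exp (ξ (Fin.last n)) - 1 with hEf
  set Lf : (Fin (n + 1) → ℂ) → ℂ := fun ξ => lam * m + η₀f ξ + Ef ξ with hLf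
  set uf : (Fin (n + 1) → ℂ) → (Fin n → ℂ) := fun ξ j =>
    (η₀f ξ + Ef ξ) * νc j + ((d j : ℂ) * lm + ℓ j + ξ (Fin.castSucc j)) with huf
  set xf : (Fin (n + 1) → ℂ) → (Fin n → ℂ) := fun ξ => (m : ℂ) • v + uf ξ with hxf
  set Gf : Fin n → (Fin (n + 1) → ℂ) → ℂ := fun i ξ =>
    (eval (xf ξ) (T i) - t i * (m : ℂ) ^ d i +
      ∑ m' ∈ S i, eval (xf ξ) (A i m') * exp (((m' : ℂ) - νc i) * Lf ξ)) *
      (t i * (m : ℂ) ^ d i)⁻¹ with hGf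
  set Gl : (Fin (n + 1) → ℂ) → ℂ := fun ξ =>
    Ef ξ - eval (xf ξ) H * ((m : ℂ) ^ (D - 1) * β)⁻¹ with hGl
  set G : Fin (n + 1) → (Fin (n + 1) → ℂ) → ℂ :=
    Fin.snoc (α := fun _ => (Fin (n + 1) → ℂ) → ℂ) Gf Gl with hG
  -- ### differentiability
  have hproj : ∀ j : Fin (n + 1), Differentiable ℂ (fun ξ : Fin (n + 1) → ℂ => ξ j) :=
    fun j => differentiable_apply j
  have hη₀_diff : Differentiable ℂ η₀f := by
    have h3 := fun j (_ : j ∈ (Finset.univ : Finset (Fin n))) =>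
      ((hproj (Fin.castSucc j)).const_add ((d j : ℂ) * lm + ℓ j)).mul_const (gD j)
    exact (((Differentiable.fun_sum h3).add_const h1).neg).mul_const β⁻¹
  have hEf_diff : Differentiable ℂ Ef := ((hproj (Fin.last n)).cexp).sub_const 1
  have hLf_diff : Differentiable ℂ Lf := (hη₀_diff.const_add _).add hEf_diff
  have hxf_diff : ∀ j, Differentiable ℂ fun ξ => xf ξ j := by
    intro j
    exact ((((hη₀_diff.add hEf_diff).mul_const (νc j)).add
      ((hproj (Fin.castSucc j)).const_add ((d j : ℂ) * lm + ℓ j))).const_add ((m : ℂ) * v j))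
  have heval_diff : ∀ p : MvPolynomial (Fin n) ℂ, Differentiable ℂ fun ξ => eval (xf ξ) p :=
    fun p ξ => DifferentiableAt.mvPolynomial_eval p fun i => (hxf_diff i) ξ
  have hG_diff : ∀ j, Differentiable ℂ (G j) := by
    intro j
    refine Fin.lastCases ?_ (fun j => ?_) j
    · have h2 := hEf_diff.sub ((heval_diff H).mul_const ((m : ℂ) ^ (D - 1) * β)⁻¹)
      simp only [hG, Fin.snoc_last]
      exact h2
    · have h3 := fun m' (_ : m' ∈ S j) =>
        (heval_diff (A j m')).mul ((hLf_diff.const_mul ((m' : ℂ) - νc j)).cexp)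
      have h4 := (((heval_diff (T j)).sub_const (t j * (m : ℂ) ^ d j)).add
        (Differentiable.fun_sum h3)).mul_const (t j * (m : ℂ) ^ d j)⁻¹
      simp only [hG, Fin.snoc_castSucc]
      exact h4
  -- ### bounds on the unit polydisc
  have hball : ∀ ξ ∈ ball (0 : Fin (n + 1) → ℂ) 1, ∀ j, ‖ξ j‖ ≤ 1 := by
    intro ξ hξ j
    rw [mem_ball, dist_zero_right] at hξ
    exact (norm_le_pi_norm ξ j).trans hξ.le
  have hwj : ∀ ξ ∈ ball (0 : Fin (n + 1) → ℂ) 1, ∀ j,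
      ‖(d j : ℂ) * lm + ℓ j + ξ (Fin.castSucc j)‖ ≤ W := by
    intro ξ hξ j
    have e1 : ‖(d j : ℂ) * (lm : ℂ)‖ ≤ c₁ * lm := by
      rw [norm_mul, Complex.norm_natCast, Complex.norm_real, Real.norm_of_nonneg hlog0]
      exact mul_le_mul_of_nonneg_right (hdc₁ j) hlog0
    calc _ ≤ ‖(d j : ℂ) * (lm : ℂ)‖ + ‖ℓ j‖ + ‖ξ (Fin.castSucc j)‖ := norm_add₃_le
      _ ≤ c₁ * lm + ‖ℓ‖ + 1 := by linarith [norm_le_pi_norm ℓ j, hball ξ hξ (Fin.castSucc j)]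
      _ = W := by simp only [hW, hc₂]; ring
  have hη₀b : ∀ ξ ∈ ball (0 : Fin (n + 1) → ℂ) 1, ‖η₀f ξ‖ ≤ G₁ * W + G₂ := by
    intro ξ hξ
    calc ‖η₀f ξ‖ = ‖(∑ j, ((d j : ℂ) * lm + ℓ j + ξ (Fin.castSucc j)) * gD j) + h1‖ * ‖β‖⁻¹ := by
          simp only [hη₀f]; rw [norm_mul, norm_neg, norm_inv]
      _ ≤ ((∑ j, W * ‖gD j‖) + ‖h1‖) * ‖β‖⁻¹ := by
          refine mul_le_mul_of_nonneg_right ?_ (by positivity)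
          refine (norm_add_le _ _).trans (add_le_add ?_ le_rfl)
          refine (norm_sum_le _ _).trans (Finset.sum_le_sum fun j _ => ?_)
          rw [norm_mul]
          exact mul_le_mul_of_nonneg_right (hwj ξ hξ j) (norm_nonneg _)
      _ = G₁ * W + G₂ := by rw [hG₁, hG₂, ← Finset.mul_sum]; ring
  have hEb : ∀ ξ ∈ ball (0 : Fin (n + 1) → ℂ) 1, ‖Ef ξ‖ ≤ 2 := by
    intro ξ hξ
    have := Complex.norm_exp_sub_one_le (hball ξ hξ (Fin.last n))
    simp only [hEf]; linarith [hball ξ hξ (Fin.last n)]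
  have hub : ∀ ξ ∈ ball (0 : Fin (n + 1) → ℂ) 1, ‖uf ξ‖ ≤ a₁ * lm + a₂ := by
    intro ξ hξ
    have hle : ((G₁ * W + G₂) + 2) * ‖νc‖ + W = a₁ * lm + a₂ := by linarith [hWm]
    rw [pi_norm_le_iff_of_nonneg (by positivity), ← hle]
    intro j
    simp only [huf]
    have e1 : ‖(η₀f ξ + Ef ξ) * νc j‖ ≤ ((G₁ * W + G₂) + 2) * ‖νc‖ := by
      rw [norm_mul]
      exact mul_le_mul ((norm_add_le _ _).trans (add_le_add (hη₀b ξ hξ) (hEb ξ hξ)))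
        (norm_le_pi_norm νc j) (norm_nonneg _) (by positivity)
    exact (norm_add_le _ _).trans (add_le_add e1 (hwj ξ hξ j))
  have hρm : (G₁ * W + G₂) + 2 ≤ ρ / 2 * m := by
    have h1' : Fr m * m = 1 + a₁ * lm + a₂ := by simp only [hFr, hlm]; field_simp
    have h2' : (G₁ * W + G₂) + 2 ≤ 1 + a₁ * lm + a₂ := by
      have hP : 0 ≤ G₁ * W + G₂ + 2 := by positivity
      have := mul_le_mul_of_nonneg_left hν1 hP
      rw [hWm]; linarith
    calc (G₁ * W + G₂) + 2 ≤ Fr m * m := by rw [h1']; exact h2'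
      _ ≤ ρ / 2 * m := mul_le_mul_of_nonneg_right hFr2 hmpos.le
  have hLre : ∀ ξ ∈ ball (0 : Fin (n + 1) → ℂ) 1, ρ / 2 * m ≤ (Lf ξ).re := by
    intro ξ hξ
    simp only [hLf, Complex.add_re]
    have e1 : (lam * (m : ℂ)).re = ρ * m := by simp [hρ]
    have e2 := (Complex.abs_re_le_norm (η₀f ξ)).trans (hη₀b ξ hξ)
    have e3 := (Complex.abs_re_le_norm (Ef ξ)).trans (hEb ξ hξ)
    rw [e1]
    linarith [(abs_le.mp e2).1, (abs_le.mp e3).1]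
  have hxb : ∀ ξ ∈ ball (0 : Fin (n + 1) → ℂ) 1, 1 + ‖xf ξ‖ ≤ Kx * (1 + m) := by
    intro ξ hξ
    have h1' : ‖xf ξ‖ ≤ m * ‖v‖ + ‖uf ξ‖ := by
      simp only [hxf]
      refine (norm_add_le _ _).trans (add_le_add ?_ le_rfl)
      rw [norm_smul, hmnorm]
    rw [hKx]
    nlinarith [hub ξ hξ, norm_nonneg v, norm_nonneg (uf ξ), mul_nonneg ha₁0 hlog0,
      mul_le_mul_of_nonneg_left hlmm ha₁0]
  have hbound : ∀ j, ∀ ξ ∈ ball (0 : Fin (n + 1) → ℂ) 1, ‖G j ξ‖ ≤ ε := by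
    intro j ξ hξ
    have hxfe : xf ξ = (m : ℂ) • v + uf ξ := rfl
    have hu1 : 1 + ‖uf ξ‖ ≤ 1 + a₁ * lm + a₂ := by linarith [hub ξ hξ]
    refine Fin.lastCases ?_ (fun j => ?_) j
    · -- the base equation
      simp only [hG, Fin.snoc_last, hGl]
      have hkey : (∑ j, uf ξ j * gD j) + h1 = Ef ξ * β := by
        have e1 : ∑ j, uf ξ j * gD j = (η₀f ξ + Ef ξ) * β +
            ∑ j, ((d j : ℂ) * lm + ℓ j + ξ (Fin.castSucc j)) * gD j := by
          rw [hβdef, Finset.mul_sum, ← Finset.sum_add_distrib]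
          refine Finset.sum_congr rfl fun j _ => ?_
          simp only [huf]; ring
        have e2 : η₀f ξ * β = -((∑ j, ((d j : ℂ) * lm + ℓ j + ξ (Fin.castSucc j)) * gD j) + h1) := by
          simp only [hη₀f]; rw [mul_assoc, inv_mul_cancel₀ hβ0, mul_one]
        rw [e1]; linear_combination e2
      have hray := hC2 (m : ℂ) (by rw [hmnorm]; exact hm1) (uf ξ)
      rw [← hxfe, ← hHD, hroot, mul_zero, sub_zero, hkey, hmnorm] at hray
      have e3 : Ef ξ - eval (xf ξ) H * ((m : ℂ) ^ (D - 1) * β)⁻¹ =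
          -(eval (xf ξ) H - (m : ℂ) ^ (D - 1) * (Ef ξ * β)) * ((m : ℂ) ^ (D - 1) * β)⁻¹ := by
        field_simp
        ring
      rw [e3, norm_mul, norm_neg, norm_inv, norm_mul, norm_pow, hmnorm, ← div_eq_mul_inv,
        div_le_iff₀ (by positivity)]
      refine hray.trans ?_
      have e4 : (1 + ‖uf ξ‖) ^ N2 ≤ (1 + a₁ * lm + a₂) ^ N2 := pow_le_pow_left₀ (by positivity) hu1 _
      have hFl' : Fl m * (m ^ (D - 1) * ‖β‖) = C2 * (1 + a₁ * lm + a₂) ^ N2 * m ^ (D - 1) / m := by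
        simp only [hFl, hlm]; field_simp
      calc C2 * (1 + ‖uf ξ‖) ^ N2 * m ^ (D - 1) / m
          ≤ C2 * (1 + a₁ * lm + a₂) ^ N2 * m ^ (D - 1) / m := by
            refine div_le_div_of_nonneg_right ?_ hmpos.le
            exact mul_le_mul_of_nonneg_right (mul_le_mul_of_nonneg_left e4 hC20) (by positivity)
        _ = Fl m * (m ^ (D - 1) * ‖β‖) := hFl'.symm
        _ ≤ ε * (m ^ (D - 1) * ‖β‖) := mul_le_mul_of_nonneg_right hFlε (by positivity)
    · -- the fibre coordinates
      simp only [hG, Fin.snoc_castSucc, hGf]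
      have htn : 0 < ‖t j‖ := norm_pos_iff.mpr (ht0 j)
      have hden : 0 < ‖t j‖ * m ^ d j := by positivity
      rw [norm_mul, norm_inv, norm_mul, norm_pow, hmnorm, ← div_eq_mul_inv, div_le_iff₀ hden]
      have e1 : ‖eval (xf ξ) (T j) - t j * (m : ℂ) ^ d j‖ ≤
          CT j * (1 + a₁ * lm + a₂) ^ NT j * 2 ^ d j * m ^ d j / m := by
        rw [hxfe]
        have h := norm_top_sub_le (T j) v (hCT0 j) (hCT j) hm2 (τ := (m : ℂ))
          (by rw [hmnorm]; linarith) (by rw [hmnorm]; linarith) (uf ξ)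
        refine h.trans (div_le_div_of_nonneg_right ?_ hmpos.le)
        refine mul_le_mul_of_nonneg_right (mul_le_mul_of_nonneg_right ?_ (by positivity))
          (by positivity)
        exact mul_le_mul_of_nonneg_left (pow_le_pow_left₀ (by positivity) hu1 _) (hCT0 j)
      set Sx : ℝ := ∑ m' ∈ S j,
        CA j m' * Kx ^ NA j m' * ((1 + m) ^ NA j m' * Real.exp (-(ρ / 2 * m - 0))) with hSx
      have hS0 : 0 ≤ Sx := Finset.sum_nonneg fun i _ =>
        mul_nonneg (mul_nonneg (hCA0 j i) (pow_nonneg hKx0 _))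
          (mul_nonneg (pow_nonneg (by linarith) _) (Real.exp_pos _).le)
      have e2 : ‖∑ m' ∈ S j, eval (xf ξ) (A j m') * exp (((m' : ℂ) - νc j) * Lf ξ)‖ ≤ Sx := by
        refine (norm_sum_le _ _).trans (Finset.sum_le_sum fun m' hm' => ?_)
        have hlt : (m' : ℝ) - (ν j : ℝ) ≤ -1 := by
          have := hS j m' hm'
          have : (m' : ℝ) + 1 ≤ (ν j : ℝ) := by exact_mod_cast this
          linarith
        rw [norm_mul]
        have f1 : ‖eval (xf ξ) (A j m')‖ ≤ CA j m' * Kx ^ NA j m' * (1 + m) ^ NA j m' := by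
          refine (hCA j m' (xf ξ)).trans ?_
          rw [mul_assoc, ← mul_pow]
          exact mul_le_mul_of_nonneg_left (pow_le_pow_left₀ (by positivity) (hxb ξ hξ) _)
            (hCA0 j m')
        have f2 : ‖exp (((m' : ℂ) - νc j) * Lf ξ)‖ ≤ Real.exp (-(ρ / 2 * m - 0)) := by
          rw [Complex.norm_exp, Real.exp_le_exp, sub_zero]
          have hre' : (((m' : ℂ) - νc j) * Lf ξ).re = ((m' : ℝ) - (ν j : ℝ)) * (Lf ξ).re := by
            simp [hνc, Complex.mul_re]
          rw [hre']
          have hL := hLre ξ hξ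
          have hLpos : 0 ≤ (Lf ξ).re := by
            have : 0 ≤ ρ / 2 * m := by positivity
            linarith
          nlinarith
        calc ‖eval (xf ξ) (A j m')‖ * ‖exp (((m' : ℂ) - νc j) * Lf ξ)‖
            ≤ (CA j m' * Kx ^ NA j m' * (1 + m) ^ NA j m') * Real.exp (-(ρ / 2 * m - 0)) :=
              mul_le_mul f1 f2 (norm_nonneg _)
                (mul_nonneg (mul_nonneg (hCA0 j m') (pow_nonneg hKx0 _))
                  (pow_nonneg (by linarith) _))
          _ = CA j m' * Kx ^ NA j m' * ((1 + m) ^ NA j m' * Real.exp (-(ρ / 2 * m - 0))) := by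
              ring
      have hmd : 1 ≤ m ^ d j := one_le_pow₀ hm1
      have hFj : Ff j m * (‖t j‖ * m ^ d j) =
          CT j * (1 + a₁ * lm + a₂) ^ NT j * 2 ^ d j * m ^ d j / m + Sx * m ^ d j := by
        simp only [hFf, hlm]
        rw [← hSx]
        field_simp
      calc ‖eval (xf ξ) (T j) - t j * (m : ℂ) ^ d j + ∑ m' ∈ S j,
              eval (xf ξ) (A j m') * exp (((m' : ℂ) - νc j) * Lf ξ)‖
          ≤ CT j * (1 + a₁ * lm + a₂) ^ NT j * 2 ^ d j * m ^ d j / m + Sx :=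
            (norm_add_le _ _).trans (add_le_add e1 e2)
        _ ≤ CT j * (1 + a₁ * lm + a₂) ^ NT j * 2 ^ d j * m ^ d j / m + Sx * m ^ d j :=
            add_le_add le_rfl (le_mul_of_one_le_right hS0 hmd)
        _ = Ff j m * (‖t j‖ * m ^ d j) := hFj.symm
        _ ≤ ε * (‖t j‖ * m ^ d j) := mul_le_mul_of_nonneg_right (hFε j) (by positivity)
  -- ### the fixed point and the exponential point
  have hε' : 16 * ((n + 1 : ℕ) + 1 : ℝ) * ε ≤ 1 := by
    rw [hε]; push_cast
    have : (16 : ℝ) * (n + 1 + 1) * (1 / (16 * (n + 2))) = 1 := by field_simp; ring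
    rw [this]
  obtain ⟨ξ, hξ, hfix⟩ :=
    Literature.NumberTheory.Transcendental.ExpDominant.exists_exp_eq_one_add G hεpos.le hε'
      (fun j => (hG_diff j).differentiableOn) hbound
  refine ⟨xf ξ, Lf ξ, ?_, fun i => ?_⟩
  · have hlast := hfix (Fin.last n)
    simp only [hG, Fin.snoc_last, hGl, hEf] at hlast
    have h0 : eval (xf ξ) H * ((m : ℂ) ^ (D - 1) * β)⁻¹ = 0 := by linear_combination hlast
    rcases mul_eq_zero.mp h0 with h | h
    · exact h
    · exact absurd h (inv_ne_zero hmD)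
  · have hi := hfix (Fin.castSucc i)
    simp only [hG, Fin.snoc_castSucc, hGf] at hi
    have hxi : xf ξ i = Lf ξ * νc i + ((d i : ℂ) * lm + ℓ i + ξ (Fin.castSucc i)) +
        ((mN * q i : ℤ) : ℂ) * (2 * Real.pi * I) := by
      simp only [hxf, huf, hLf, hv, hνc, hm, Pi.add_apply, Pi.smul_apply, smul_eq_mul]
      push_cast; ring
    have hmpow : exp ((d i : ℂ) * (lm : ℂ)) = (m : ℂ) ^ d i := by
      rw [Complex.exp_nat_mul, hlm, Complex.ofReal_log hmpos.le, Complex.exp_log hmC]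
    have htm : t i * (m : ℂ) ^ d i ≠ 0 := mul_ne_zero (ht0 i) (pow_ne_zero _ hmC)
    have hct : ∀ z : ℂ, t i * (m : ℂ) ^ d i * (z * (t i * (m : ℂ) ^ d i)⁻¹) = z := fun z => by
      rw [mul_comm z, ← mul_assoc, mul_inv_cancel₀ htm, one_mul]
    have hpow : ∀ m' : ℤ, exp (Lf ξ * νc i) * exp (((m' : ℂ) - νc i) * Lf ξ) =
        exp ((m' : ℂ) * Lf ξ) := by
      intro m'; rw [← Complex.exp_add]; congr 1; ring
    calc exp (xf ξ i) = exp (Lf ξ * νc i) * (exp ((d i : ℂ) * (lm : ℂ)) * exp (ℓ i) *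
          exp (ξ (Fin.castSucc i))) * exp (((mN * q i : ℤ) : ℂ) * (2 * Real.pi * I)) := by
          rw [hxi, Complex.exp_add, Complex.exp_add, Complex.exp_add, Complex.exp_add]
      _ = exp (Lf ξ * νc i) * (t i * (m : ℂ) ^ d i + (eval (xf ξ) (T i) - t i * (m : ℂ) ^ d i +
            ∑ m' ∈ S i, eval (xf ξ) (A i m') * exp (((m' : ℂ) - νc i) * Lf ξ))) := by
          rw [Complex.exp_int_mul_two_pi_mul_I, mul_one, hmpow, hexpℓ, hi, mul_add, mul_one,
            mul_comm ((m : ℂ) ^ d i) (t i), hct]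
      _ = eval (xf ξ) (T i) * exp ((ν i : ℂ) * Lf ξ) +
            ∑ m' ∈ S i, eval (xf ξ) (A i m') * exp ((m' : ℂ) * Lf ξ) := by
          have hsum : exp (Lf ξ * νc i) * ∑ m' ∈ S i,
              eval (xf ξ) (A i m') * exp (((m' : ℂ) - νc i) * Lf ξ) =
                ∑ m' ∈ S i, eval (xf ξ) (A i m') * exp ((m' : ℂ) * Lf ξ) := by
            rw [Finset.mul_sum]
            refine Finset.sum_congr rfl fun m' _ => ?_
            rw [← hpow m']; ring
          rw [mul_add, mul_add, hsum]
          simp only [hνc]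
          ring

end Summit.Schanuel.Schanuel.Theorems
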